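import Literature.MathematicalPhysics.QuantumManyBody.BoseGasSubcellCondensationDilute
import Summits.AtomisticToContinuum.BoseEinsteinCondensation.Theses.HealingPivotCascade
import Summits.AtomisticToContinuum.BoseEinsteinCondensation.Theses.NumberPhaseSandwich
import Summits.AtomisticToContinuum.BoseEinsteinCondensation.Theses.DetailResponseLadder
import Summits.AtomisticToContinuum.BoseEinsteinCondensation.Theses.GapWindowLadder

/-!
# `DiluteFloor` (stmt-AtomisticToContinuum-32060) PROVED — the dilute healing floor, by name from the in-tree floor theorems

decomp-a2c prover hand-1 (generation 18), (S)-lane.  The shared support item `DiluteFloor` (routes HealingPivotCascade /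
NumberPhaseSandwich / DetailResponseLadder / GapWindowLadder) is, verbatim, the common conclusion (for every `M > 0`) of the PROVED tree
theorems `Literature.MathematicalPhysics.QuantumManyBody.BoseGas.floor_of_scatteringLength_zero` / `…floor_of_scatteringLength_pos`
(`BoseGasSubcellCondensationDilute`): for every admissible `v` and `M > 0` there is `ρ₀ > 0` such that for `0 < ρ < ρ₀`, eventually in `N`,
every `1`-near-minimiser has sub-cell occupation floor `S_k ≥ 7N/8` at every dyadic level `k` with `M/√ρ ≤ L_N/2^k < 2M/√ρ`.  Discharge =
the dichotomy `scatteringLength v = 0 ∨ 0 < scatteringLength v` (the item's own informal note).  The four route decls are the same term;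
each is proved by name.  No definitions, no `sorry`, standard axioms.  `--workitem stmt-AtomisticToContinuum-32060`.
-/

noncomputable section

open Literature.MathematicalPhysics.QuantumManyBody.BoseGas

namespace Summit.AtomisticToContinuum.BoseEinsteinCondensation.Theses.HealingPivotCascade

/-- ★ **`DiluteFloor` PROVED** (route HealingPivotCascade's decl of item stmt-AtomisticToContinuum-32060): the in-tree floor theorems over the
dichotomy on the scattering length. [this file] -/
theorem diluteFloor_proof : DiluteFloor := fun _ hv _ hM =>
  (eq_zero_or_pos (scatteringLength _)).elim (fun h0 => floor_of_scatteringLength_zero hv h0 hM)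
    (fun hp => floor_of_scatteringLength_pos hv hp hM)

end Summit.AtomisticToContinuum.BoseEinsteinCondensation.Theses.HealingPivotCascade

namespace Summit.AtomisticToContinuum.BoseEinsteinCondensation.Theses.NumberPhaseSandwich

/-- `DiluteFloor` in route NumberPhaseSandwich's spelling (same term). [this file] -/
theorem diluteFloor_proof : DiluteFloor := HealingPivotCascade.diluteFloor_proof

end Summit.AtomisticToContinuum.BoseEinsteinCondensation.Theses.NumberPhaseSandwich

namespace Summit.AtomisticToContinuum.BoseEinsteinCondensation.Theses.DetailResponseLadder

/-- `DiluteFloor` in route DetailResponseLadder's spelling (same term). [this file] -/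
theorem diluteFloor_proof : DiluteFloor := HealingPivotCascade.diluteFloor_proof

end Summit.AtomisticToContinuum.BoseEinsteinCondensation.Theses.DetailResponseLadder

namespace Summit.AtomisticToContinuum.BoseEinsteinCondensation.Theses.GapWindowLadder

/-- `DiluteFloor` in route GapWindowLadder's spelling (same term). [this file] -/
theorem diluteFloor_proof : DiluteFloor := HealingPivotCascade.diluteFloor_proof

end Summit.AtomisticToContinuum.BoseEinsteinCondensation.Theses.GapWindowLadder
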